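import Mathlib.MeasureTheory.Measure.Haar.Unique
import Literature.MathematicalPhysics.QuantumLattice.LatticeGaugeDLR
import HarnessLib

/-!
# Discharges for lattice gauge theory on `ℤ^d` (`LatticeGaugeDLR`): gauge covariance of the
lattice Yang–Mills specification

Trunk QLatticeAQFT (item A9 `LatticeGaugeDLR`), family `constructive-qft`. Sibling proof file of
`Literature/MathematicalPhysics/QuantumLattice/LatticeGaugeDLR.lean`: it discharges named facts
(`def X : Prop`, D-0014) of that file as `theorem X_holds : X`, from Mathlib and the API already
proved there. No statement is introduced or changed here.

Discharged:

* `Literature.AQFT.ymSpecification_map_gaugeTransformZd_holds : ymSpecification_map_gaugeTransformZd` —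
  the Wilson (lattice Yang–Mills) specification `γ_Λ(· | η) = ymSpecification ρ β Λ η` is gauge
  covariant: `γ_Λ(· | η) ∘ (U ↦ U^g)⁻¹ = γ_Λ(· | η^g)` for every gauge transformation
  `U^g(x,i) = g(x) U(x,i) g(x+eᵢ)⁻¹`.

Auxiliary (general, all theorems; no definition or statement is added): `measurable_gaugeTransformZd`,
`gaugeTransformZd_inv_gaugeTransformZd` / `gaugeTransformZd_gaugeTransformZd_inv` (the
transformation by `g⁻¹` inverts the one by `g`, so `U ↦ U^g` is a measurable equivalence, built
inline in the discharge),
`tilted_map_of_measurableEquiv` (`(μ.tilted f) ∘ e⁻¹ = (μ ∘ e⁻¹).tilted f` when `f ∘ e = f`),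
`measurePreserving_mul_mul_inv_haarProbability` (two-sided invariance `x ↦ a x b⁻¹` of the
normalised Haar measure of a compact group), `map_gaugeTransformZd_pi_map_glueWith` (gauge
covariance of the a priori measure `Haar^{⊗Λ} ⊗ δ_{η_{Λᶜ}}`).

## Sources

* E. Seiler, *Gauge Theories as a Problem of Constructive Quantum Field Theory and Statistical
  Mechanics*, LNP 159 (Springer 1982), Ch. 1–2: the Wilson action is gauge invariant and the
  finite-volume Gibbs states with boundary condition are built from the (bi-invariant) Haar
  measure, whence the DLR kernels are gauge covariant. (The book is not held in the local store;
  an acquisition request is filed. The proof below is the standard two-line argument and uses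
  only the vendored definitions.)
* H.-O. Georgii, *Gibbs Measures and Phase Transitions* (2011), Def. 2.9 (Gibbsian specification
  `ρ_Λ = (λ^Λ ⊗ δ_{ω_{Λᶜ}})` tilted by `exp(-β H_Λ)`), the form in which `ymSpecification` is
  written.

## Proof sketch (`ymSpecification_map_gaugeTransformZd_holds`)

Write `T = gaugeTransformZd g`, `ν_η = (Haar^{⊗Λ}).map (glueWith Λ · η)` and
`f = -β S_Λ` (`S_Λ = wilsonBoundaryAction ρ Λ`), so `γ_Λ(· | η) = ν_η.tilted f`.
1. `T` is a measurable bijection with measurable inverse `gaugeTransformZd g⁻¹`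
   (`measurable_gaugeTransformZd`, `gaugeTransformZd_inv_gaugeTransformZd`), and `f ∘ T = f`
   (`wilsonBoundaryAction_gaugeTransformZd`, proved in `LatticeGaugeDLR.lean`).
2. For a measurable equivalence `e` with `f ∘ e = f`, `(μ.tilted f).map e = (μ.map e).tilted f`:
   the normalisers `∫ exp f d(μ ∘ e⁻¹) = ∫ exp (f ∘ e) dμ` agree, and on a measurable `s` both
   sides are `∫_{e⁻¹ s} exp f / Z dμ` (`Measure.restrict_map`, `lintegral_map_equiv`). No
   measurability of `f` is needed, so the hypotheses `Continuous ρ`, `SecondCountableTopology G`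
   of the named fact are not used.
3. `ν_η.map T = ν_{T η}`: `T ∘ glueWith Λ · η = glueWith Λ · (T η) ∘ Φ` with
   `Φ ζ (x,i) = g(x) ζ(x,i) g(x+eᵢ)⁻¹` edgewise on `G^Λ`, and `Φ` preserves `Haar^{⊗Λ}`
   (`measurePreserving_pi`) because `x ↦ a x b⁻¹ = (a b⁻¹) · (b x b⁻¹)` preserves the Haar
   probability measure of the compact group `G`: conjugation is a continuous surjective
   automorphism (`MonoidHom.measurePreserving`, uniqueness of Haar measure on compact groups) and
   left translations preserve Haar measure (`measurePreserving_mul_left`).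
-/

noncomputable section

open MeasureTheory
open Literature.Probability.LatticeModels

namespace Literature.MathematicalPhysics.QuantumLattice

variable {d N : ℕ} {G : Type*} [Group G]

/-! ### Gauge transformations: group structure and measurability -/

/-- Gauge transforming by `g` and then by the pointwise inverse `g⁻¹` is the identity:
`(U^g)^{g⁻¹} = U` (Seiler LNP 159 Ch. 1, the gauge group acts on configurations). [folklore] -/
theorem gaugeTransformZd_inv_gaugeTransformZd (g : Site d → G) (U : LGConfig d G) :
    gaugeTransformZd g⁻¹ (gaugeTransformZd g U) = U := by
  funext e
  simp [gaugeTransformZd, mul_assoc]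

/-- Gauge transforming by `g⁻¹` and then by `g` is the identity: `(U^{g⁻¹})^g = U`
(Seiler LNP 159 Ch. 1). [folklore] -/
theorem gaugeTransformZd_gaugeTransformZd_inv (g : Site d → G) (U : LGConfig d G) :
    gaugeTransformZd g (gaugeTransformZd g⁻¹ U) = U := by
  simpa using gaugeTransformZd_inv_gaugeTransformZd g⁻¹ U

section Measurable

variable [MeasurableSpace G] [MeasurableMul G]

/-- Gauge transformations `U ↦ U^g` are measurable for the product σ-algebra on
`LGConfig d G = (ZdEdge d → G)` (each coordinate `U ↦ g(x) U(x,i) g(x+eᵢ)⁻¹` is a two-sided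
translate of a coordinate projection). [folklore] -/
theorem measurable_gaugeTransformZd (g : Site d → G) :
    Measurable (gaugeTransformZd (G := G) g) := by
  refine measurable_pi_lambda _ fun e => ?_
  have he : Measurable fun U : LGConfig d G => U e := measurable_pi_apply e
  show Measurable fun U : LGConfig d G => g e.1 * U e * (g (e.1 + Pi.single e.2 1))⁻¹
  exact (he.const_mul (g e.1)).mul_const (g (e.1 + Pi.single e.2 1))⁻¹

end Measurable

/-! ### Tilting commutes with invariant measurable equivalences -/

/-- If a measurable equivalence `e` leaves the tilting function invariant, `f ∘ e = f`, then
pushing forward commutes with tilting: `(μ.tilted f).map e = (μ.map e).tilted f`. Both sides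
have the same normaliser `∫ exp f d(μ.map e) = ∫ exp (f ∘ e) dμ = ∫ exp f dμ`, and on a
measurable set `s` both equal `∫_{e⁻¹ s} exp f / Z dμ`. No measurability of `f` is needed
(change of variables along a measurable equivalence). [folklore] -/
theorem tilted_map_of_measurableEquiv {α : Type*} [MeasurableSpace α] (μ : Measure α)
    (e : α ≃ᵐ α) (f : α → ℝ) (hf : ∀ x, f (e x) = f x) :
    (μ.tilted f).map e = (μ.map e).tilted f := by
  ext s hs
  rw [Measure.map_apply e.measurable hs, tilted_apply' _ _ (e.measurable hs), tilted_apply' _ _ hs,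
    integral_map_equiv, Measure.restrict_map e.measurable hs, lintegral_map_equiv]
  simp only [hf]

/-! ### Two-sided invariance of the Haar probability measure of a compact group -/

section Haar

variable [TopologicalSpace G] [IsTopologicalGroup G] [CompactSpace G] [MeasurableSpace G]
  [BorelSpace G]

/-- On a compact group the normalised Haar measure is invariant under the two-sided translations
`x ↦ a x b⁻¹`: writing `a x b⁻¹ = (a b⁻¹) (b x b⁻¹)`, conjugation by `b` is a continuous
surjective automorphism of the compact group `G`, hence Haar-measure preserving by uniqueness of
Haar measure (Mathlib `MonoidHom.measurePreserving`), and left translations preserve Haar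
measure. (Equivalently: compact groups are unimodular.) [folklore] -/
theorem measurePreserving_mul_mul_inv_haarProbability (a b : G) :
    MeasurePreserving (fun x : G => a * x * b⁻¹) (QuantumFieldTheory.haarProbability G)
      (QuantumFieldTheory.haarProbability G) := by
  haveI : (QuantumFieldTheory.haarProbability G).IsHaarMeasure :=
    Measure.isHaarMeasure_haarMeasure _
  have hconj : MeasurePreserving ((MulAut.conj b).toMonoidHom : G →* G)
      (QuantumFieldTheory.haarProbability G) (QuantumFieldTheory.haarProbability G) :=
    MonoidHom.measurePreserving (IsTopologicalGroup.continuous_conj b) (MulAut.conj b).surjective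
      rfl
  have h := (measurePreserving_mul_left (QuantumFieldTheory.haarProbability G) (a * b⁻¹)).comp hconj
  have hfun : (fun x : G => a * x * b⁻¹) =
      (fun x : G => a * b⁻¹ * x) ∘ ((MulAut.conj b).toMonoidHom : G →* G) := by
    funext x
    simp [mul_assoc]
  rw [hfun]
  exact h

/-- The edgewise two-sided translation `ζ ↦ (e ↦ g(x) ζ(e) g(x+eᵢ)⁻¹)`, `e = (x, i) ∈ Λ`, i.e.
the gauge transformation by `g` read on the finitely many edges of `Λ`, preserves the product
Haar measure `Haar^{⊗Λ}` (Mathlib `measurePreserving_pi` and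
`measurePreserving_mul_mul_inv_haarProbability`) (Seiler LNP 159 Ch. 2: the a priori measure of
lattice gauge theory is gauge invariant). [folklore] -/
theorem measurePreserving_gaugeTransform_pi (Λ : Finset (ZdEdge d)) (g : Site d → G) :
    MeasurePreserving
      (fun (ζ : ↥Λ → G) (e : ↥Λ) => g e.1.1 * ζ e * (g (e.1.1 + Pi.single e.1.2 1))⁻¹)
      (Measure.pi fun _ : ↥Λ => QuantumFieldTheory.haarProbability G)
      (Measure.pi fun _ : ↥Λ => QuantumFieldTheory.haarProbability G) :=
  measurePreserving_pi (f := fun (e : ↥Λ) (x : G) => g e.1.1 * x * (g (e.1.1 + Pi.single e.1.2 1))⁻¹)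
    _ _ fun e => measurePreserving_mul_mul_inv_haarProbability (g e.1.1)
      (g (e.1.1 + Pi.single e.1.2 1))

/-- Gauge covariance of the a priori measure of the lattice Yang–Mills specification: pushing
`Haar^{⊗Λ} ⊗ δ_{η_{Λᶜ}}` (product Haar measure on the edges of `Λ` glued with `η` off `Λ`) forward
under the gauge transformation by `g` gives `Haar^{⊗Λ} ⊗ δ_{η^g_{Λᶜ}}`, because on `Λ` the gauge
transformation is an edgewise two-sided translation, which preserves `Haar^{⊗Λ}`, and off `Λ` it
transforms the boundary condition (Seiler LNP 159 Ch. 2). [folklore] -/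
theorem map_gaugeTransformZd_pi_map_glueWith (Λ : Finset (ZdEdge d)) (η : LGConfig d G)
    (g : Site d → G) :
    ((Measure.pi fun _ : ↥Λ => QuantumFieldTheory.haarProbability G).map (glueWith Λ · η)).map
        (gaugeTransformZd g) =
      (Measure.pi fun _ : ↥Λ => QuantumFieldTheory.haarProbability G).map
        (glueWith Λ · (gaugeTransformZd g η)) := by
  have hΦ := measurePreserving_gaugeTransform_pi (G := G) Λ g
  have hcomm : gaugeTransformZd g ∘ (fun ζ : ↥Λ → G => glueWith Λ ζ η) =
      (fun ζ : ↥Λ → G => glueWith Λ ζ (gaugeTransformZd g η)) ∘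
        fun (ζ : ↥Λ → G) (e : ↥Λ) => g e.1.1 * ζ e * (g (e.1.1 + Pi.single e.1.2 1))⁻¹ := by
    funext ζ e
    by_cases he : e ∈ Λ
    · simp [gaugeTransformZd, he]
    · simp [gaugeTransformZd, he]
  rw [Measure.map_map (measurable_gaugeTransformZd g) (measurable_glueWith Λ η), hcomm,
    ← Measure.map_map (measurable_glueWith Λ _) hΦ.measurable, hΦ.map_eq]

/-! ### The discharge -/

variable (ρ : G →* Matrix (Fin N) (Fin N) ℂ)

/-- **Discharge of `ymSpecification_map_gaugeTransformZd`.** The lattice Yang–Mills (Wilson)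
specification is gauge covariant: `(γ_Λ(· | η)).map (U ↦ U^g) = γ_Λ(· | η^g)` for every finite
edge set `Λ`, boundary condition `η`, gauge transformation `g : ℤ^d → G` and every real `β`.
Proof: `γ_Λ(· | η)` is the a priori measure `Haar^{⊗Λ} ⊗ δ_{η_{Λᶜ}}` tilted by `-β S_Λ`; the
Wilson boundary action `S_Λ` is gauge invariant (`wilsonBoundaryAction_gaugeTransformZd`), so
tilting commutes with the (invertible, measurable) gauge transformation
(`tilted_map_of_measurableEquiv`), and the a priori measure is gauge covariant by bi-invariance
of Haar measure on the compact group `G` (`map_gaugeTransformZd_pi_map_glueWith`). The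
hypotheses `Continuous ρ` and `SecondCountableTopology G` of the named fact are not needed
(Seiler LNP 159 Ch. 1–2: gauge invariance of the Wilson action and of the Haar a priori
measure; Georgii 2011 Def. 2.9 for the form of the kernels). [cite: SeilerLNP1982, Ch. 2 (lattice gauge theories: locality and gauge covariance of the Wilson specification)] -/
theorem ymSpecification_map_gaugeTransformZd_holds :
    ymSpecification_map_gaugeTransformZd (d := d) ρ := by
  intro _ _ β Λ η g
  simp only [ymSpecification]
  -- the gauge transformation by `g` as a measurable equivalence, inverse: transformation by `g⁻¹`
  let e : LGConfig d G ≃ᵐ LGConfig d G :=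
    { toFun := gaugeTransformZd g
      invFun := gaugeTransformZd g⁻¹
      left_inv := gaugeTransformZd_inv_gaugeTransformZd g
      right_inv := gaugeTransformZd_gaugeTransformZd_inv g
      measurable_toFun := measurable_gaugeTransformZd g
      measurable_invFun := measurable_gaugeTransformZd g⁻¹ }
  have he : (⇑e : LGConfig d G → LGConfig d G) = gaugeTransformZd g := rfl
  have h := tilted_map_of_measurableEquiv
    ((Measure.pi fun _ : ↥Λ => QuantumFieldTheory.haarProbability G).map (glueWith Λ · η))
    e (fun U => -β * wilsonBoundaryAction ρ Λ U) fun U => by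
      show -β * wilsonBoundaryAction ρ Λ (gaugeTransformZd g U) = -β * wilsonBoundaryAction ρ Λ U
      rw [wilsonBoundaryAction_gaugeTransformZd]
  rw [he] at h
  rw [h, map_gaugeTransformZd_pi_map_glueWith]

end Haar

end Literature.MathematicalPhysics.QuantumLattice
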